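import Literature.MathematicalPhysics.QuantumLattice.HubbardTwoPointMoments
import HarnessLib

/-!
# The time-grid substitution of the Hubbard torus: position–time fields on an `N`-point time lattice and the EXACT
# locality of the strictly-conserving quartic vertex for `N ≥ 4M − 1`

Topic `MathematicalPhysics/QuantumLattice`; companion of `HubbardVertexFieldSubstitution` / `HubbardTwoPointMoments` (the
position–time fields `positionField L M β c σ x⃗ s = (βL²)⁻¹ Σ_k conj(e^{-is_c k·(x⃗,s)}) ψ̂^c_{kσ}` at REAL times `s`, realised by the
substitution matrix `vertexSubMatrix` of `n` vertices).  Two points.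

(1) A point-set–generic substitution.  `vertexSubMatrix L M β x τ` is indexed by `VertexLeg n = (Fin n × Fin 2) × Fin 2`; the
same matrix for an ARBITRARY finite set `P` of space–time points `(x⃗_p, τ_p)` is `gridSubMatrix L M β x τ : Matrix (HubbardFieldIdx L M)
(GridLeg P) ℂ` (`GridLeg P = (P × Fin 2) × Fin 2`), with `vertexSubMatrix = gridSubMatrix` definitionally for `P = Fin n`
(`vertexSubMatrix_eq_gridSubMatrix`), `map (toLin' S) (gen ((p,σ),c)) = positionField β c σ (x p) (τ p)` (`map_gridSub_gen`), and
the pulled-back propagators `Sᵀ C S` of a normal covariance as space–time character sums (`gridSub_pullback_normalCovariance_apply_zero_one`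
& co., verbatim from the vertex file).

(2) The `N`-point time grid and the locality of the vertex.  On the finite Grassmann algebra of the Hubbard torus with `2M`
Matsubara frequencies (`HubbardEffectiveAction.hubbardInteraction`: `V = U(βL²)⁻³ Σ ψ̂⁺_{k₁↑}ψ̂⁻_{k₂↑}ψ̂⁺_{k₃↓}ψ̂⁻_{k₄↓}` over
`k₁ + k₃ = k₂ + k₄` with the integer frequency labels conserved STRICTLY — the sharp truncation of BGM 2006 (2.6a)) the vertex is
local in CONTINUOUS time (`HubbardInteractionMoments.linearMap_apply_hubbardInteraction_pow`: `∫₀^β dτ`) but NOT on the `2M`-point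
dual time lattice of `SpaceTimeIdx L M` (strict ≠ modulo-`2M` conservation; `SectorisedKernelNorm`, module doc T1: the position
`L¹` norm of `V` there grows like `(log 2M)²`).  On the grid of `N` times `τ_j = jβ/N` with `N ≥ 4M − 1` the discrepancy disappears:
the frequency transfer `m = n₀ − n₁ + n₂ − n₃` of a vertex has `|m| ≤ 4M − 2 < N`, so `Σ_{j<N} e^{2πi m j/N} = N·[N ∣ m] = N·[m = 0]`
and the grid-LOCAL quartic `U (β/N) Σ_{j, x⃗} ψ⁺↑ψ⁻↑ψ⁺↓ψ⁻↓(x⃗, jβ/N)` maps EXACTLY to `hubbardInteraction`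
(**`map_hubbardGridSub_gridInteraction`**).  This is the Riemann sum of Salmhofer's time-lattice action ((4.54)–(4.58)) taken
fine enough to be exact on trigonometric polynomials of degree `< 2M` in each leg — the device by which the strictly-conserving
vertex of the `M → ∞` bridge (`HubbardPartitionFunctionMatsubaraLimit`, `HubbardTwoPointMatsubaraLimit`) becomes an ultralocal
vertex for position-space `L¹–L^∞` norms, uniformly in `M`.

* `GridLeg`, `gridSubMatrix`, `gridSubMatrix_apply`, `vertexSubMatrix_eq_gridSubMatrix`, `map_gridSub_gen`,
  `gridSub_pullback_apply`, `gridSub_pullback_normalCovariance_apply_zero_one/_one_zero/_of_charge_eq`;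
* `gridTime β N j = jβ/N`, `GridPoint L N = Fin N × (ℤ/Lℤ)²`, `hubbardGridSub L M β N`, `gridWord`, `hubbardGridInteraction L N β U`
  (`= U(β/N) Σ_p gridWord p`), `hubbardGridQuadratic L N β` (`= (β/N) Σ_{p,σ} ψ⁺_{pσ}ψ⁻_{pσ}`, the local quadratic term of the Hartree
  counterterm), their vanishing constant parts;
* `map_hubbardGridSub_gridWord` (the image of a grid word is the vertex field word of ONE vertex at that point),
  `sum_exp_freqTransfer_gridTime` (discrete orthogonality on the grid), `natAbs_vertexFreqTransfer_le` (`|m| ≤ 4M − 2`),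
  **`map_hubbardGridSub_gridInteraction`** (`4M ≤ N + 1`, `β ≠ 0`).

Everything is proved; the definitions are the substitution matrix, the grid data and the two local polynomials; no named facts.

## Sources

G. Benfatto, A. Giuliani, V. Mastropietro, Ann. Henri Poincaré 7 (2006) 809–898 = arXiv:cond-mat/0507686, §2.1 (2.5)–(2.6a)
[`BenfattoGiulianiMastropietro2006`]; M. Salmhofer, *Renormalization* (1999), §4.2.4 (4.54)–(4.59) [`Salmhofer1999`].
-/

noncomputable section

namespace Literature.MathematicalPhysics.QuantumLattice

open GrassmannAlgebra Finset Literature.Probability.LatticeModels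
open scoped ComplexConjugate

/-! ### (1) The point-set–generic substitution -/

section Generic

/-- The **legs at a set of points** `P`: `((p, σ), c)` = (point, spin, charge; `0 ↦ ψ⁺`, `1 ↦ ψ⁻`), as `VertexLeg n` for `P = Fin n`.
[cite: BenfattoGiulianiMastropietro2006, §2.1 (2.5)] -/
abbrev GridLeg (P : Type*) : Type _ := (P × Fin 2) × Fin 2

variable (L M : ℕ)

/-- **The substitution matrix of the position–time fields at the points `(x⃗_p, τ_p)`, `p ∈ P`**: the generator of leg
`((p,σ),c)` is `ψ^c_{(x⃗_p,τ_p),σ} = (βL²)⁻¹ Σ_k conj(e^{-is_c k·(x⃗_p,τ_p)}) ψ̂^c_{k,σ}` (BGM 2006, (2.5); `vertexSubMatrix` is the case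
`P = Fin n`). [cite: BenfattoGiulianiMastropietro2006, §2.1 (2.5)] -/
def gridSubMatrix (β : ℝ) {P : Type*} (x : P → TorusSite 2 L) (τ : P → ℝ) : Matrix (HubbardFieldIdx L M) (GridLeg P) ℂ :=
  Matrix.of fun K Y => if K.1.2 = Y.1.2 ∧ K.2 = Y.2 then
    ((1 / (β * (L : ℝ) ^ 2) : ℝ) : ℂ) * conj (vertexPlaneWave L M β Y.2 K.1.1 (x Y.1.1) (τ Y.1.1)) else 0

variable {L M}

/-- Unfolding `gridSubMatrix` (the coefficients `(βL²)⁻¹ conj(e^{-is_c k·x})` of BGM (2.5)). [cite: BenfattoGiulianiMastropietro2006, §2.1 (2.5)] -/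
theorem gridSubMatrix_apply (β : ℝ) {P : Type*} (x : P → TorusSite 2 L) (τ : P → ℝ) (K : HubbardFieldIdx L M) (Y : GridLeg P) :
    gridSubMatrix L M β x τ K Y = if K.1.2 = Y.1.2 ∧ K.2 = Y.2 then
      ((1 / (β * (L : ℝ) ^ 2) : ℝ) : ℂ) * conj (vertexPlaneWave L M β Y.2 K.1.1 (x Y.1.1) (τ Y.1.1)) else 0 := rfl

/-- The vertex-field substitution of `n` vertices is the grid substitution for `P = Fin n` (same fields, BGM (2.5)). [cite: BenfattoGiulianiMastropietro2006, §2.1 (2.5)] -/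
theorem vertexSubMatrix_eq_gridSubMatrix (β : ℝ) {n : ℕ} (x : Fin n → TorusSite 2 L) (τ : Fin n → ℝ) :
    vertexSubMatrix L M β x τ = gridSubMatrix L M β x τ := rfl

variable [NeZero L] {P : Type*}

/-- **The substitution realises the position–time fields**: `map (toLin' S) (gen ((p,σ),c)) = positionField β c σ (x⃗_p) (τ_p)`.
[cite: BenfattoGiulianiMastropietro2006, §2.1 (2.5)] -/
theorem map_gridSub_gen [Fintype P] [DecidableEq P] (β : ℝ) (x : P → TorusSite 2 L) (τ : P → ℝ) (Y : GridLeg P) :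
    ExteriorAlgebra.map (Matrix.toLin' (gridSubMatrix L M β x τ)) (gen ℂ Y) = positionField L M β Y.2 Y.1.2 (x Y.1.1) (τ Y.1.1) := by
  rw [map_gen_eq_sum, LinearMap.toMatrix'_toLin', positionField]
  simp only [gridSubMatrix_apply, ite_smul, zero_smul, sum_fieldIdx_ite]

/-- **The pulled-back covariance of the grid fields** for an arbitrary momentum-space covariance `C`:
`(Sᵀ C S)(Y, Y') = Σ_{k,k'} a_Y(k) C(((k,σ),c),((k',σ'),c')) a_{Y'}(k')`, `a_Y(k) = (βL²)⁻¹ conj(e^{-is_c k·x_p})`.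
[cite: Salmhofer1999, App. B.2 (B.23)-(B.25)] -/
theorem gridSub_pullback_apply (β : ℝ) (x : P → TorusSite 2 L) (τ : P → ℝ)
    (C : Matrix (HubbardFieldIdx L M) (HubbardFieldIdx L M) ℂ) (Y Y' : GridLeg P) :
    ((gridSubMatrix L M β x τ).transpose * C * gridSubMatrix L M β x τ) Y Y' =
      ∑ k : FreqMomentum L M, ∑ k' : FreqMomentum L M,
        (((1 / (β * (L : ℝ) ^ 2) : ℝ) : ℂ) * conj (vertexPlaneWave L M β Y.2 k (x Y.1.1) (τ Y.1.1))) *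
          C ((k, Y.1.2), Y.2) ((k', Y'.1.2), Y'.2) *
        (((1 / (β * (L : ℝ) ^ 2) : ℝ) : ℂ) * conj (vertexPlaneWave L M β Y'.2 k' (x Y'.1.1) (τ Y'.1.1))) := by
  rw [Matrix.mul_apply]
  have h1 : ∀ K' : HubbardFieldIdx L M, ((gridSubMatrix L M β x τ).transpose * C) Y K' * gridSubMatrix L M β x τ K' Y' =
      if K'.1.2 = Y'.1.2 ∧ K'.2 = Y'.2 then ((gridSubMatrix L M β x τ).transpose * C) Y K' *
        (((1 / (β * (L : ℝ) ^ 2) : ℝ) : ℂ) * conj (vertexPlaneWave L M β Y'.2 K'.1.1 (x Y'.1.1) (τ Y'.1.1)))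
        else 0 := by
    intro K'
    rw [gridSubMatrix_apply]
    split_ifs <;> simp
  simp_rw [h1]
  rw [sum_fieldIdx_ite, sum_comm]
  refine sum_congr rfl fun k' _ => ?_
  rw [Matrix.mul_apply]
  have h2 : ∀ K : HubbardFieldIdx L M, (gridSubMatrix L M β x τ).transpose Y K * C K ((k', Y'.1.2), Y'.2) =
      if K.1.2 = Y.1.2 ∧ K.2 = Y.2 then
        (((1 / (β * (L : ℝ) ^ 2) : ℝ) : ℂ) * conj (vertexPlaneWave L M β Y.2 K.1.1 (x Y.1.1) (τ Y.1.1))) *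
          C K ((k', Y'.1.2), Y'.2) else 0 := by
    intro K
    rw [Matrix.transpose_apply, gridSubMatrix_apply]
    split_ifs <;> simp
  simp_rw [h2]
  rw [sum_fieldIdx_ite, sum_mul]

/-- **Normal covariances pull back to normal-ordered propagators, `(+, −)` entry**: for `C = normalCovariance p`,
`(Sᵀ C S)((p,σ,+),(p',σ',−)) = [σ = σ'] (βL²)⁻² Σ_k e^{i(k·x_p − k·x_{p'})} p(k,σ)` (the position-space propagator (2.3)–(2.4) of
BGM at finite cutoff). [cite: BenfattoGiulianiMastropietro2006, §2.1 (2.3)] -/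
theorem gridSub_pullback_normalCovariance_apply_zero_one (β : ℝ) (x : P → TorusSite 2 L) (τ : P → ℝ)
    (p : FreqMomentum L M × Fin 2 → ℂ) (a b : P) (σ σ' : Fin 2) :
    ((gridSubMatrix L M β x τ).transpose * normalCovariance L M p * gridSubMatrix L M β x τ) ((a, σ), 0) ((b, σ'), 1) =
      if σ = σ' then ∑ k : FreqMomentum L M, ((1 / (β * (L : ℝ) ^ 2) : ℝ) : ℂ) ^ 2 *
        (Complex.exp (((vertexPhase L M β k (x a) (τ a) - vertexPhase L M β k (x b) (τ b) : ℝ) : ℂ) * Complex.I) *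
          p (k, σ)) else 0 := by
  rw [gridSub_pullback_apply]
  by_cases hσ : σ = σ'
  · subst hσ
    simp only [normalCovariance_apply, Prod.mk.injEq, and_true, Fin.isValue, and_self, if_true, mul_ite, ite_mul,
      mul_zero, zero_mul, Finset.sum_ite_eq, Finset.mem_univ]
    refine sum_congr rfl fun k _ => ?_
    calc ((1 / (β * (L : ℝ) ^ 2) : ℝ) : ℂ) * conj (vertexPlaneWave L M β 0 k (x a) (τ a)) * p (k, σ) *
          (((1 / (β * (L : ℝ) ^ 2) : ℝ) : ℂ) * conj (vertexPlaneWave L M β 1 k (x b) (τ b)))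
        = ((1 / (β * (L : ℝ) ^ 2) : ℝ) : ℂ) ^ 2 * ((conj (vertexPlaneWave L M β 0 k (x a) (τ a)) *
            conj (vertexPlaneWave L M β 1 k (x b) (τ b))) * p (k, σ)) := by ring
      _ = _ := by rw [conj_vertexPlaneWave_zero_mul_one]
  · rw [if_neg hσ]
    refine sum_eq_zero fun k _ => sum_eq_zero fun k' _ => ?_
    rw [normalCovariance_apply, if_neg (fun h => hσ (Prod.mk.inj h).2), mul_zero, zero_mul]

/-- **The `(−, +)` entry is minus the transposed `(+, −)` entry** (antisymmetry of `Sᵀ C S`, BGM (2.3)). [cite: BenfattoGiulianiMastropietro2006, §2.1 (2.3)] -/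
theorem gridSub_pullback_normalCovariance_apply_one_zero (β : ℝ) (x : P → TorusSite 2 L) (τ : P → ℝ)
    (p : FreqMomentum L M × Fin 2 → ℂ) (a b : P) (σ σ' : Fin 2) :
    ((gridSubMatrix L M β x τ).transpose * normalCovariance L M p * gridSubMatrix L M β x τ) ((a, σ), 1) ((b, σ'), 0) =
      -((gridSubMatrix L M β x τ).transpose * normalCovariance L M p * gridSubMatrix L M β x τ) ((b, σ'), 0) ((a, σ), 1) := by
  set S := gridSubMatrix L M β x τ
  have hT : (S.transpose * normalCovariance L M p * S).transpose = -(S.transpose * normalCovariance L M p * S) := by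
    rw [Matrix.transpose_mul, Matrix.transpose_mul, Matrix.transpose_transpose, normalCovariance_transpose,
      Matrix.neg_mul, Matrix.mul_neg, Matrix.mul_assoc]
  have h := congrFun (congrFun hT ((b, σ'), 0)) ((a, σ), 1)
  rw [Matrix.transpose_apply, Matrix.neg_apply] at h
  exact h

/-- The pulled-back normal covariance is antisymmetric (a fermionic propagator, BGM (2.3)). [cite: BenfattoGiulianiMastropietro2006, §2.1 (2.3)] -/
theorem gridSub_pullback_normalCovariance_transpose (β : ℝ) (x : P → TorusSite 2 L) (τ : P → ℝ)
    (p : FreqMomentum L M × Fin 2 → ℂ) :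
    ((gridSubMatrix L M β x τ).transpose * normalCovariance L M p * gridSubMatrix L M β x τ).transpose =
      -((gridSubMatrix L M β x τ).transpose * normalCovariance L M p * gridSubMatrix L M β x τ) := by
  rw [Matrix.transpose_mul, Matrix.transpose_mul, Matrix.transpose_transpose, normalCovariance_transpose,
    Matrix.neg_mul, Matrix.mul_neg, Matrix.mul_assoc]

/-- **Equal charges do not contract**: `(Sᵀ C S)((p,σ,c),(p',σ',c)) = 0` for a normal covariance (BGM (2.3) pairs `ψ⁻` with `ψ⁺`). [cite: BenfattoGiulianiMastropietro2006, §2.1 (2.3)] -/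
theorem gridSub_pullback_normalCovariance_apply_of_charge_eq (β : ℝ) (x : P → TorusSite 2 L) (τ : P → ℝ)
    (p : FreqMomentum L M × Fin 2 → ℂ) {Y Y' : GridLeg P} (h : Y.2 = Y'.2) :
    ((gridSubMatrix L M β x τ).transpose * normalCovariance L M p * gridSubMatrix L M β x τ) Y Y' = 0 := by
  rw [gridSub_pullback_apply]
  refine sum_eq_zero fun k _ => sum_eq_zero fun k' _ => ?_
  have h0 : normalCovariance L M p ((k, Y.1.2), Y.2) ((k', Y'.1.2), Y'.2) = 0 :=
    normalCovariance_apply_of_charge_eq p (X := ((k, Y.1.2), Y.2)) (Y := ((k', Y'.1.2), Y'.2)) h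
  rw [h0, mul_zero, zero_mul]

/-- **Different spins do not contract** for a normal covariance (`δ_{σσ'}` in BGM (2.3)). [cite: BenfattoGiulianiMastropietro2006, §2.1 (2.3)] -/
theorem gridSub_pullback_normalCovariance_apply_of_spin_ne (β : ℝ) (x : P → TorusSite 2 L) (τ : P → ℝ)
    (p : FreqMomentum L M × Fin 2 → ℂ) {Y Y' : GridLeg P} (h : Y.1.2 ≠ Y'.1.2) :
    ((gridSubMatrix L M β x τ).transpose * normalCovariance L M p * gridSubMatrix L M β x τ) Y Y' = 0 := by
  rw [gridSub_pullback_apply]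
  refine sum_eq_zero fun k _ => sum_eq_zero fun k' _ => ?_
  have h0 : normalCovariance L M p ((k, Y.1.2), Y.2) ((k', Y'.1.2), Y'.2) = 0 := by
    rw [normalCovariance_apply, if_neg]
    exact fun h1 => h (Prod.mk.inj h1).2
  rw [h0, mul_zero, zero_mul]

end Generic

/-! ### (2) The `N`-point time grid and the exact locality of the vertex -/

section Grid

/-- The grid times `τ_j = jβ/N`, `j < N`. [cite: Salmhofer1999, §4.2.4 (4.55)] -/
def gridTime (β : ℝ) (N : ℕ) (j : Fin N) : ℝ := (j : ℝ) * β / N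

/-- The **space–time grid points** `(j, x⃗)`: a time index `j < N` and a site of `(ℤ/Lℤ)²`. [cite: Salmhofer1999, §4.2.4 (4.55)] -/
abbrev GridPoint (L N : ℕ) : Type := Fin N × TorusSite 2 L

variable (L M : ℕ) [NeZero L]

/-- **The grid substitution of the Hubbard torus**: the position–time fields at all grid points `(x⃗, jβ/N)`.
[cite: BenfattoGiulianiMastropietro2006, §2.1 (2.5)] -/
def hubbardGridSub (β : ℝ) (N : ℕ) : Matrix (HubbardFieldIdx L M) (GridLeg (GridPoint L N)) ℂ :=
  gridSubMatrix L M β (fun p : GridPoint L N => p.2) (fun p => gridTime β N p.1)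

variable {M} (N : ℕ)

/-- The **grid word** `ψ⁺_{p↑} ψ⁻_{p↑} ψ⁺_{p↓} ψ⁻_{p↓}` at the grid point `p` (generators of the grid algebra).
[cite: BenfattoGiulianiMastropietro2006, §2.1 (2.6a)] -/
def gridWord (p : GridPoint L N) : GrassmannAlgebra ℂ (GridLeg (GridPoint L N)) :=
  gen ℂ (((p, 0), 0) : GridLeg (GridPoint L N)) * gen ℂ (((p, 0), 1) : GridLeg (GridPoint L N)) *
    gen ℂ (((p, 1), 0) : GridLeg (GridPoint L N)) * gen ℂ (((p, 1), 1) : GridLeg (GridPoint L N))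

/-- **The grid-local quartic interaction** `V_N = U ε_N Σ_{j,x⃗} ψ⁺↑ψ⁻↑ψ⁺↓ψ⁻↓(x⃗, jβ/N)`, `ε_N = β/N` (Salmhofer's time-lattice
action (4.58) for the Hubbard vertex; the Riemann sum of BGM's `U∫dx ψ⁺↑ψ⁻↑ψ⁺↓ψ⁻↓`, (2.6a)). [cite: Salmhofer1999, §4.2.4 (4.58)] -/
def hubbardGridInteraction (β U : ℝ) : GrassmannAlgebra ℂ (GridLeg (GridPoint L N)) :=
  ((U * (β / N) : ℝ) : ℂ) • ∑ p : GridPoint L N, gridWord L N p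

/-- **The grid-local quadratic term** `N₂ = ε_N Σ_{j,x⃗,σ} ψ⁺_{σ}ψ⁻_{σ}(x⃗, jβ/N)` (the density; the carrier of the local quadratic part of
the effective action / the Hartree counterterm). [cite: Salmhofer1999, §4.2.4 (4.58)] -/
def hubbardGridQuadratic (β : ℝ) : GrassmannAlgebra ℂ (GridLeg (GridPoint L N)) :=
  (((β / N) : ℝ) : ℂ) • ∑ p : GridPoint L N, ∑ σ : Fin 2,
    gen ℂ (((p, σ), 0) : GridLeg (GridPoint L N)) * gen ℂ (((p, σ), 1) : GridLeg (GridPoint L N))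

variable {L N}

omit [NeZero L] in
/-- The grid word has no constant part (a quartic monomial of the action (4.58)). [cite: Salmhofer1999, §4.2.4 (4.58)] -/
theorem constPart_gridWord (p : GridPoint L N) : constPart ℂ (gridWord L N p) = 0 := by
  simp [gridWord]

/-- The grid interaction has no constant part (Salmhofer's (4.58) is a polynomial without constant term). [cite: Salmhofer1999, §4.2.4 (4.58)] -/
theorem constPart_hubbardGridInteraction (β U : ℝ) : constPart ℂ (hubbardGridInteraction L N β U) = 0 := by
  simp [hubbardGridInteraction, map_sum, constPart_gridWord]

/-- The grid quadratic term has no constant part. [cite: Salmhofer1999, §4.2.4 (4.58)] -/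
theorem constPart_hubbardGridQuadratic (β : ℝ) : constPart ℂ (hubbardGridQuadratic L N β) = 0 := by
  simp [hubbardGridQuadratic, map_sum]

/-- **The image of a grid word is the vertex field word of one vertex at that point.** [cite: BenfattoGiulianiMastropietro2006, §2.1 (2.6a)] -/
theorem map_hubbardGridSub_gridWord (β : ℝ) (p : GridPoint L N) :
    ExteriorAlgebra.map (Matrix.toLin' (hubbardGridSub L M β N)) (gridWord L N p) =
      vertexFieldWord L M β ![p.2] ![gridTime β N p.1] 0 := by
  rw [gridWord, map_mul, map_mul, map_mul, hubbardGridSub, map_gridSub_gen, map_gridSub_gen, map_gridSub_gen, map_gridSub_gen,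
    vertexFieldWord, map_vertexSub_gen_eq_positionField, map_vertexSub_gen_eq_positionField, map_vertexSub_gen_eq_positionField,
    map_vertexSub_gen_eq_positionField]
  rfl

omit [NeZero L] in
/-- **The frequency transfer of a vertex is at most `4M − 2` in modulus** (each integer label lies in `[-M, M)`, the frequency set of
Salmhofer (4.63)). [cite: Salmhofer1999, §4.2.4 (4.63)] -/
theorem natAbs_vertexFreqTransfer_le (κ : Fin 4 → FreqMomentum L M) : (vertexFreqTransfer L M κ).natAbs + 2 ≤ 4 * M := by
  have h : ∀ i : Fin 4, -(M : ℤ) ≤ matsubaraInt M (κ i).1 ∧ matsubaraInt M (κ i).1 + 1 ≤ M := by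
    intro i
    have hi := (κ i).1.isLt
    simp only [matsubaraInt]
    constructor <;> omega
  have h0 := h 0; have h1 := h 1; have h2 := h 2; have h3 := h 3
  unfold vertexFreqTransfer
  omega

omit [NeZero L] in
/-- **Discrete orthogonality on the time grid**: for an integer `m` with `|m| < N`,
`Σ_{j<N} e^{2πi m (jβ/N)/β} = N·[m = 0]` (`β ≠ 0`; the orthogonality relation of the time lattice, Salmhofer (4.59)).
[cite: Salmhofer1999, §4.2.4 (4.59)] -/
theorem sum_exp_freqTransfer_gridTime {β : ℝ} (hβ : β ≠ 0) {N : ℕ} {m : ℤ} (hm : m.natAbs < N) :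
    ∑ j : Fin N, Complex.exp (((2 * Real.pi * m * gridTime β N j / β : ℝ) : ℂ) * Complex.I) =
      if m = 0 then (N : ℂ) else 0 := by
  have hN : (N : ℂ) ≠ 0 := by
    have : 0 < N := lt_of_le_of_lt (Nat.zero_le _) hm
    exact_mod_cast this.ne'
  have hβ' : (β : ℂ) ≠ 0 := by exact_mod_cast hβ
  -- the summand is `ζ^j` with `ζ = e^{2πi m/N}`
  set ζ : ℂ := Complex.exp (((2 * Real.pi * m / N : ℝ) : ℂ) * Complex.I) with hζ
  have hterm : ∀ j : Fin N, Complex.exp (((2 * Real.pi * m * gridTime β N j / β : ℝ) : ℂ) * Complex.I) = ζ ^ (j : ℕ) := by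
    intro j
    rw [hζ, ← Complex.exp_nat_mul, gridTime]
    congr 1
    push_cast
    field_simp
  simp_rw [hterm]
  rw [Fin.sum_univ_eq_sum_range (fun i => ζ ^ i)]
  split_ifs with h0
  · have h1 : ζ = 1 := by rw [hζ, h0]; simp
    simp [h1]
  · -- `ζ ≠ 1` since `0 < |m| < N`, and `ζ^N = 1`
    have hζ1 : ζ ≠ 1 := by
      intro h
      rw [hζ, Complex.exp_eq_one_iff] at h
      obtain ⟨n, hn⟩ := h
      have hreal : (2 * Real.pi * m / N : ℝ) = n * (2 * Real.pi) := by
        have h' := congrArg Complex.im hn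
        simpa [Complex.mul_im, Complex.I_re, Complex.I_im] using h'
      have hNr : (N : ℝ) ≠ 0 := by
        have : 0 < N := lt_of_le_of_lt (Nat.zero_le _) hm
        exact_mod_cast this.ne'
      have hmn : (m : ℝ) = n * N := by
        field_simp at hreal
        linear_combination hreal
      have hmn' : m = n * N := by exact_mod_cast hmn
      have : m.natAbs < N := hm
      rw [hmn', Int.natAbs_mul, Int.natAbs_natCast] at this
      rcases eq_or_ne n 0 with hn0 | hn0
      · exact h0 (by rw [hmn', hn0, zero_mul])
      · have : 1 ≤ n.natAbs := Int.natAbs_pos.2 hn0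
        nlinarith
    have hζN : ζ ^ N = 1 := by
      rw [hζ, ← Complex.exp_nat_mul, Complex.exp_eq_one_iff]
      refine ⟨m, ?_⟩
      push_cast
      field_simp
    rw [geom_sum_eq hζ1, hζN, sub_self, zero_div]

/-- **The strictly-conserving quartic vertex is local on the `N`-point time grid, `N ≥ 4M − 1`**:
`map (toLin' S_N) (U ε_N Σ_{j,x⃗} ψ⁺↑ψ⁻↑ψ⁺↓ψ⁻↓(x⃗, jβ/N)) = hubbardInteraction L M β U` (`β ≠ 0`).  Each grid word expands as
`(βL²)⁻⁴ Σ_κ e^{2πi m(κ) jβ/(Nβ)} χ_{q(κ)}(x⃗) • ψ̂⁺ψ̂⁻ψ̂⁺ψ̂⁻(κ)` (`vertexFieldWord_eq_sum`); summing over the grid gives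
`N L² [m(κ) = 0][q(κ) = 0]` because `|m(κ)| ≤ 4M − 2 < N` (`natAbs_vertexFreqTransfer_le`, `sum_exp_freqTransfer_gridTime`,
`sum_torusChar_right`), i.e. exactly the constraint of `hubbardInteraction` (`vertexConserving_iff`, `hubbardInteraction_eq_sum_smul`).
[cite: BenfattoGiulianiMastropietro2006, §2.1 (2.5)-(2.6a)] -/
theorem map_hubbardGridSub_gridInteraction {β : ℝ} (hβ : β ≠ 0) (U : ℝ) (hN : 4 * M ≤ N + 1) [NeZero N] :
    ExteriorAlgebra.map (Matrix.toLin' (hubbardGridSub L M β N)) (hubbardGridInteraction L N β U) = hubbardInteraction L M β U := by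
  have hNr : (N : ℂ) ≠ 0 := by exact_mod_cast NeZero.ne N
  have hLr : (L : ℂ) ≠ 0 := by exact_mod_cast NeZero.ne L
  have hβ' : (β : ℂ) ≠ 0 := by exact_mod_cast hβ
  rw [hubbardGridInteraction, map_smul, map_sum]
  simp_rw [map_hubbardGridSub_gridWord, vertexFieldWord_eq_sum]
  simp only [Matrix.cons_val_zero]
  -- exchange the grid sum and the momentum sum; the grid sum of the phase is the constraint
  rw [Finset.sum_comm]
  have hgrid : ∀ κ : Fin 4 → FreqMomentum L M,
      ∑ p : GridPoint L N, ((((1 / (β * (L : ℝ) ^ 2)) ^ 4 : ℝ) : ℂ) *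
        (Complex.exp (((2 * Real.pi * (vertexFreqTransfer L M κ) * gridTime β N p.1 / β : ℝ) : ℂ) * Complex.I) *
          torusChar (vertexMomTransfer L M κ) p.2)) • vertexMonomial L M κ =
      (if vertexConserving L M κ then ((((1 / (β * (L : ℝ) ^ 2)) ^ 4 : ℝ) : ℂ) * ((N : ℂ) * (L : ℂ) ^ 2)) else 0) •
        vertexMonomial L M κ := by
    intro κ
    rw [← Finset.sum_smul]
    congr 1
    rw [← Finset.mul_sum, Fintype.sum_prod_type]
    simp_rw [← Finset.mul_sum, sum_torusChar_right, ← Finset.sum_mul]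
    have hm : (vertexFreqTransfer L M κ).natAbs < N := by
      have := natAbs_vertexFreqTransfer_le κ
      omega
    rw [sum_exp_freqTransfer_gridTime hβ hm]
    by_cases h1 : vertexFreqTransfer L M κ = 0 <;> by_cases h2 : vertexMomTransfer L M κ = 0 <;>
      simp [h1, h2, vertexConserving_iff]
  simp_rw [hgrid]
  rw [hubbardInteraction_eq_sum_smul, Finset.smul_sum]
  refine Finset.sum_congr rfl fun κ _ => ?_
  rw [smul_smul]
  congr 1
  split_ifs with hc
  · push_cast
    field_simp
  · rw [mul_zero]

end Grid

end Literature.MathematicalPhysics.QuantumLattice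

end
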